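import Summits.CriticalPhenomena.PercolationContinuityZ3.Theorems.PercNearOneGluingNoHeavyLowerTailSunflowerTwoCoinPairwise
import Summits.CriticalPhenomena.PercolationContinuityZ3.Theorems.PercNearOneGluingNoHeavyLowerTailSunflowerLinkedCurrency
import HarnessLib

/-!
# `NoHeavyLowerTail` (crux stmt-CriticalPhenomena-4575), abstract sunflower cubic: the `w`-COIN SPLIT of (RES0′) —
# (RES0′) for every number of petals on W-DOMINANT families from the `{w=1}`-face budget and the `y`-cell budget alone;
# in particular on every family with `y` at its floor (all leverage dwarfs, h-petals, H-hubs: the whole "free-g" world)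

Support file (seat `prim-ineq-prove-1` gen 59; `--supports stmt-CriticalPhenomena-4575`).  No `sorry`, no named facts.
Memo: run/shared/lean/prim/prim-ineq-prove-1/FINDING-KAPPAONE-prove1-g59.md §5.

THE SPLIT.  In the two-linked-systems model (`…SunflowerLinkedCurrency`, `…SunflowerVertexCertificate`; coins `τ, σ, s`, floors
`α₀₀ ≤ α₀₁ ≤ α₁₁`, petals `(y,k,g,h)`, `G = c₀ + τ(1−σ)Ȳ + s(1−τ)H`, `Ȳ = (1−s)y + sk`, `H = (1−σ)g + σh`) the block `(z₁,u,w)`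
splits along the `w`-coin:
  `G = (c₀ − τσ − (1−τ)(1−s)α₀₀) + s·W + (1−s)·U₀`,   `W = τσ + τ(1−σ)k + (1−τ)H` (the face `{w=1}`),
  `U₀ = τσ + τ(1−σ)y + (1−τ)α₀₀` (the face `{w=0}`, one free cell, `y`, and the pinned `m`-channel).
`W` is the value of the petal's section on the PENDANT block `(z₁,u)`; its Lemma-A budget `(BW) ∏ W_j ≤ w_f^(n−1)` is legitimate
(face `VV = (z₂=0,w=1)` of the leaf-leaf block, memo g50 §0; used numerically since gen 55).  So (RES0′) is a TWO-COIN problem in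
the currencies `W` (mass `θ = s w_f/g*`) and `U₀` (mass `θ_u = (1−s)u_f/g*`), and gen 55's THEOREM Y (`two_coin_pairwise_family_le`)
applies to every family whose petals lie on one side of the diagonal:
* **`res0_Wdominant`**: if every petal satisfies `w_f·τ(1−σ)(y_j − α₀₀) ≤ u_f·(W_j − w_f)` (relative `U₀`-excess ≤ relative
  `W`-excess) then `∏ G_j ≤ (g*)^(n−1)·a` for every `n`, from `(BW)` and `(By)` only, for every `c₀ ≥ τσ + (1−τ)(1−s)α₀₀`.
* **`res0_yfloor`**: every family with all `y_j = α₀₀` is W-dominant; so (RES0′) ∀n holds for it from `(BW)` alone.  This class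
  contains every leverage dwarf `(α₀₀,t,t,t)`, every h-petal, every H-hub and k-hub — i.e. ALL the "free-g × voluntary-h" families
  (memo g54 §4) and all the resonant families `α₁₁^N = α₀₁^(N−1)` on which no six-budget certificate scheme is uniform (memo §2):
  with the face `{w=1}` priced they are one line (the pendant theorem already did the work).
What is left of (RES0′) after this file and `res0_kappa_one`: families mixing W-dominant petals with CHEAP-`y` petals
(`y`-excess without matching `W`-excess), whose coupling is the `Ȳ`-face budget (memo §5).
-/

noncomputable section

namespace Summit.CriticalPhenomena.PercolationContinuityZ3.Theorems.SunflowerPartition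

namespace SafeCalc

namespace LinkedCurrency

open Finset

variable {κ : Type*}

/-- **(RES0′) ∀n for W-dominant families, from the `{w=1}`-face budget and the `y`-cell budget.**
Coins `0 < τ < 1`, `0 ≤ σ < 1`, `0 < s < 1`; floors `0 < α₀₀ ≤ α₀₁ ≤ α₁₁`; `c₀ ≥ τσ + (1−τ)(1−s)α₀₀`; petals with `α₀₀ ≤ y_j`,
`α₀₁ ≤ k_j`, `α₀₁ ≤ g_j`, `α₁₁ ≤ h_j` (no caps, no links needed); W-dominance
`w_f·τ(1−σ)(y_j − α₀₀) ≤ u_f·(W_j − w_f)` with `W_j = τσ + τ(1−σ)k_j + (1−τ)((1−σ)g_j + σh_j)`, `w_f = W(floor)`,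
`u_f = τσ + τ(1−σ)α₀₀ + (1−τ)α₀₀`; budgets `∏ W_j ≤ w_f^(|S|−1)` and `∏ y_j ≤ α₀₀^(|S|−1)`.  Then
`∏ (c₀ + τ(1−σ)Ȳ_j + s(1−τ)H_j) ≤ (g*)^(|S|−1)(c₀ + τ(1−σ) + s(1−τ))`.  Proof: THEOREM Y on the `w`-coin split. [this work] -/
theorem res0_Wdominant [DecidableEq κ] {τ σ s α00 α01 α11 c0 : ℝ} (hτ0 : 0 < τ) (hτ1 : τ < 1) (hσ0 : 0 ≤ σ)
    (hσ1 : σ < 1) (hs0 : 0 < s) (hs1 : s < 1) (hα0 : 0 < α00) (h01 : α00 ≤ α01) (h11 : α01 ≤ α11)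
    (hc0 : τ * σ + (1 - τ) * (1 - s) * α00 ≤ c0)
    (S : Finset κ) (hS : S.Nonempty) (y k gc h : κ → ℝ)
    (hy : ∀ j ∈ S, α00 ≤ y j) (hk : ∀ j ∈ S, α01 ≤ k j) (hg : ∀ j ∈ S, α01 ≤ gc j) (hh : ∀ j ∈ S, α11 ≤ h j)
    (hdom : ∀ j ∈ S, (τ * σ + τ * (1 - σ) * α01 + (1 - τ) * ((1 - σ) * α01 + σ * α11)) * (τ * (1 - σ) * (y j - α00)) ≤
      (τ * σ + τ * (1 - σ) * α00 + (1 - τ) * α00) *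
        (τ * σ + τ * (1 - σ) * k j + (1 - τ) * ((1 - σ) * gc j + σ * h j) -
          (τ * σ + τ * (1 - σ) * α01 + (1 - τ) * ((1 - σ) * α01 + σ * α11))))
    (hBW : ∏ j ∈ S, (τ * σ + τ * (1 - σ) * k j + (1 - τ) * ((1 - σ) * gc j + σ * h j)) ≤
      (τ * σ + τ * (1 - σ) * α01 + (1 - τ) * ((1 - σ) * α01 + σ * α11)) ^ (S.card - 1))
    (hBy : ∏ j ∈ S, y j ≤ α00 ^ (S.card - 1)) :
    ∏ j ∈ S, (c0 + τ * (1 - σ) * ((1 - s) * y j + s * k j) + s * (1 - τ) * ((1 - σ) * gc j + σ * h j)) ≤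
      (c0 + τ * (1 - σ) * ((1 - s) * α00 + s * α01) + s * (1 - τ) * ((1 - σ) * α01 + σ * α11)) ^ (S.card - 1) *
        (c0 + τ * (1 - σ) + s * (1 - τ)) := by
  have hτ1' : 0 < 1 - τ := sub_pos.2 hτ1
  have hσ1' : 0 < 1 - σ := sub_pos.2 hσ1
  have hs1' : 0 < 1 - s := sub_pos.2 hs1
  have hα01 : 0 < α01 := lt_of_lt_of_le hα0 h01
  have hα11 : 0 < α11 := lt_of_lt_of_le hα01 h11
  obtain ⟨p, hp⟩ : ∃ e : ℝ, e = τ * (1 - σ) := ⟨_, rfl⟩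
  simp only [← hp] at hdom hBW ⊢
  have hp0 : 0 < p := by rw [hp]; exact mul_pos hτ0 hσ1'
  -- the two face floors and the full `W`
  obtain ⟨wf, hwf⟩ : ∃ e : ℝ, e = τ * σ + p * α01 + (1 - τ) * ((1 - σ) * α01 + σ * α11) := ⟨_, rfl⟩
  obtain ⟨uf, huf⟩ : ∃ e : ℝ, e = τ * σ + p * α00 + (1 - τ) * α00 := ⟨_, rfl⟩
  obtain ⟨Wv, hWv⟩ : ∃ f : κ → ℝ, f = fun j => τ * σ + p * k j + (1 - τ) * ((1 - σ) * gc j + σ * h j) :=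
    ⟨_, rfl⟩
  have hWvj : ∀ j, Wv j = τ * σ + p * k j + (1 - τ) * ((1 - σ) * gc j + σ * h j) := fun j => by rw [hWv]
  rw [← hwf] at hdom hBW
  rw [← huf] at hdom
  have hBW' : ∏ j ∈ S, Wv j ≤ wf ^ (S.card - 1) := by
    rw [prod_congr rfl fun j _ => hWvj j]; exact hBW
  have hdom' : ∀ j ∈ S, wf * (p * (y j - α00)) ≤ uf * (Wv j - wf) := fun j hj => by rw [hWvj]; exact hdom j hj
  have hwf0 : 0 < wf := by
    rw [hwf]
    have : 0 < (1 - τ) * ((1 - σ) * α01 + σ * α11) := mul_pos hτ1' (by nlinarith [mul_pos hσ1' hα01, mul_nonneg hσ0 hα11.le])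
    nlinarith [mul_nonneg hτ0.le hσ0, mul_nonneg hp0.le hα01.le]
  have huf0 : 0 < uf := by
    rw [huf]; nlinarith [mul_nonneg hτ0.le hσ0, mul_nonneg hp0.le hα0.le, mul_pos hτ1' hα0]
  have hWge : ∀ j ∈ S, wf ≤ Wv j := fun j hj => by
    rw [hWvj, hwf]
    have h1 := hk j hj; have h2 := hg j hj; have h3 := hh j hj
    have : (1 - σ) * α01 + σ * α11 ≤ (1 - σ) * gc j + σ * h j :=
      add_le_add (mul_le_mul_of_nonneg_left h2 hσ1'.le) (mul_le_mul_of_nonneg_left h3 hσ0)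
    nlinarith [mul_le_mul_of_nonneg_left h1 hp0.le, mul_le_mul_of_nonneg_left this hτ1'.le]
  -- the floor value g* and its decomposition g* = δ + s·wf + (1−s)·uf
  obtain ⟨g, hgdef⟩ : ∃ e : ℝ, e = c0 + p * ((1 - s) * α00 + s * α01) + s * (1 - τ) * ((1 - σ) * α01 + σ * α11) :=
    ⟨_, rfl⟩
  rw [← hgdef]
  obtain ⟨δ, hδ⟩ : ∃ e : ℝ, e = c0 - τ * σ - (1 - τ) * (1 - s) * α00 := ⟨_, rfl⟩
  have hδ0 : 0 ≤ δ := by rw [hδ]; linarith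
  have hgeq : g = δ + s * wf + (1 - s) * uf := by rw [hgdef, hδ, hwf, huf, hp]; ring
  have hgpos : 0 < g := by rw [hgeq]; nlinarith [mul_pos hs0 hwf0, mul_pos hs1' huf0]
  have hgne : g ≠ 0 := hgpos.ne'
  -- the two masses
  obtain ⟨εY, hεYd⟩ : ∃ e : ℝ, e = s * wf / g := ⟨_, rfl⟩
  obtain ⟨εH, hεHd⟩ : ∃ e : ℝ, e = (1 - s) * uf / g := ⟨_, rfl⟩
  have hεY0 : 0 < εY := by rw [hεYd]; exact div_pos (mul_pos hs0 hwf0) hgpos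
  have hεH0 : 0 < εH := by rw [hεHd]; exact div_pos (mul_pos hs1' huf0) hgpos
  have hsum : εY + εH ≤ 1 := by
    rw [hεYd, hεHd, ← add_div, div_le_one hgpos, hgeq]; linarith
  -- relative excesses A = (W − wf)/wf, B = p(y − α00)/uf and the excesses a = εY·A, b = εH·B
  obtain ⟨A, hA⟩ : ∃ f : κ → ℝ, f = fun j => (Wv j - wf) / wf := ⟨_, rfl⟩
  obtain ⟨B, hB⟩ : ∃ f : κ → ℝ, f = fun j => p * (y j - α00) / uf := ⟨_, rfl⟩
  have hAj : ∀ j, A j = (Wv j - wf) / wf := fun j => by rw [hA]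
  have hBj : ∀ j, B j = p * (y j - α00) / uf := fun j => by rw [hB]
  have hA0 : ∀ j ∈ S, 0 ≤ A j := fun j hj => by rw [hAj]; exact div_nonneg (sub_nonneg.2 (hWge j hj)) hwf0.le
  have hB0 : ∀ j ∈ S, 0 ≤ B j := fun j hj => by
    rw [hBj]; exact div_nonneg (mul_nonneg hp0.le (sub_nonneg.2 (hy j hj))) huf0.le
  have hside : ∀ j ∈ S, B j ≤ A j := fun j hj => by
    rw [hAj, hBj, div_le_div_iff₀ huf0 hwf0]
    have := hdom' j hj
    linarith
  obtain ⟨a, ha⟩ : ∃ f : κ → ℝ, f = fun j => εY * A j := ⟨_, rfl⟩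
  obtain ⟨b, hb⟩ : ∃ f : κ → ℝ, f = fun j => εH * B j := ⟨_, rfl⟩
  have haj : ∀ j, a j = εY * A j := fun j => by rw [ha]
  have hbj : ∀ j, b j = εH * B j := fun j => by rw [hb]
  have ha0 : ∀ j ∈ S, 0 ≤ a j := fun j hj => by rw [haj]; exact mul_nonneg hεY0.le (hA0 j hj)
  have hb0 : ∀ j ∈ S, 0 ≤ b j := fun j hj => by rw [hbj]; exact mul_nonneg hεH0.le (hB0 j hj)
  -- pairwise compatibility: same side of the diagonal (THEOREM Y's `same_side_compat`)
  have hcompat : ∀ i ∈ S, ∀ j ∈ S, i ≠ j → (a i + b i) * (a j + b j) ≤ a i * a j / εY + b i * b j / εH := by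
    intro i hi j hj _
    have key := same_side_compat (ε₁ := εY) (ε₂ := εH) hεY0.le hεH0.le hsum (hA0 i hi) (hB0 i hi) (hA0 j hj) (hB0 j hj)
      (mul_nonneg (sub_nonneg.2 (hside i hi)) (sub_nonneg.2 (hside j hj)))
    have e1 : a i * a j / εY = εY * (A i * A j) := by rw [haj, haj]; field_simp
    have e2 : b i * b j / εH = εH * (B i * B j) := by rw [hbj, hbj]; field_simp
    rw [e1, e2, haj, haj, hbj, hbj]; exact key
  have main := two_coin_pairwise_family_le hεY0 hεH0 hsum S a b ha0 hb0 hcompat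
  -- identify the factors: G_j = g (1 + a_j + b_j)
  have hfac : ∀ j ∈ S, c0 + p * ((1 - s) * y j + s * k j) + s * (1 - τ) * ((1 - σ) * gc j + σ * h j) =
      g * (1 + a j + b j) := by
    intro j _
    have e1 : g * a j = s * (Wv j - wf) := by rw [haj, hεYd, hAj]; field_simp
    have e2 : g * b j = (1 - s) * (p * (y j - α00)) := by rw [hbj, hεHd, hBj]; field_simp
    calc c0 + p * ((1 - s) * y j + s * k j) + s * (1 - τ) * ((1 - σ) * gc j + σ * h j)
        = g + s * (Wv j - wf) + (1 - s) * (p * (y j - α00)) := by rw [hgeq, hδ, hWvj, hwf, huf, hp]; ring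
      _ = g * (1 + a j + b j) := by rw [← e1, ← e2]; ring
  -- the W-currency: ∏(1 + a/εY) = ∏ W/wf ≤ 1/wf
  have hcard : 1 ≤ S.card := Finset.card_pos.2 hS
  have hWprod : εY * (∏ j ∈ S, (1 + a j / εY) - 1) ≤ s * (1 - wf) / g := by
    have e1 : ∀ j ∈ S, 1 + a j / εY = Wv j / wf := fun j _ => by
      rw [haj, hAj]; field_simp; ring
    rw [prod_congr rfl e1, prod_div_distrib, prod_const]
    have h1 : (∏ j ∈ S, Wv j) / wf ^ S.card ≤ 1 / wf := by
      rw [div_le_div_iff₀ (by positivity) hwf0, one_mul,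
        show wf ^ S.card = wf ^ (S.card - 1) * wf by
          conv_lhs => rw [show S.card = (S.card - 1) + 1 by omega, pow_succ]]
      exact mul_le_mul_of_nonneg_right hBW' hwf0.le
    have h2 : εY * ((∏ j ∈ S, Wv j) / wf ^ S.card - 1) ≤ εY * (1 / wf - 1) :=
      mul_le_mul_of_nonneg_left (by linarith) hεY0.le
    refine h2.trans (le_of_eq ?_)
    rw [hεYd]; field_simp
  -- the U₀-currency: ∏(1 + b/εH) = ∏(1 + p(y−α00)/uf) ≤ 1 + (p α00/uf)(1/α00 − 1)  (one-coin monotonicity + (By))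
  have hUprod : εH * (∏ j ∈ S, (1 + b j / εH) - 1) ≤ (1 - s) * (p * (1 - α00)) / g := by
    have e1 : ∀ j ∈ S, 1 + b j / εH = 1 + B j / 1 := fun j _ => by rw [hbj]; field_simp
    rw [prod_congr rfl e1]
    -- one-coin monotonicity from ε = p α00 / uf up to ε' = 1
    obtain ⟨η, hη⟩ : ∃ e : ℝ, e = p * α00 / uf := ⟨_, rfl⟩
    have hη0 : 0 < η := by rw [hη]; exact div_pos (mul_pos hp0 hα0) huf0
    have hη1 : η ≤ 1 := by
      rw [hη, div_le_one huf0, huf]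
      have : 0 ≤ τ * σ + (1 - τ) * α00 := add_nonneg (mul_nonneg hτ0.le hσ0) (mul_nonneg hτ1'.le hα0.le)
      linarith
    have mono := rfun_anti S B hB0 hη0 hη1
    have e2 : ∀ j ∈ S, 1 + B j / η = y j / α00 := fun j _ => by
      rw [hBj, hη, div_div_div_cancel_right₀ huf0.ne', mul_div_mul_left _ _ hp0.ne', one_add_div hα0.ne']
      congr 1; ring
    rw [prod_congr rfl e2, prod_div_distrib, prod_const] at mono
    have h1 : (∏ j ∈ S, y j) / α00 ^ S.card ≤ 1 / α00 := by
      rw [div_le_div_iff₀ (by positivity) hα0, one_mul,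
        show α00 ^ S.card = α00 ^ (S.card - 1) * α00 by
          conv_lhs => rw [show S.card = (S.card - 1) + 1 by omega, pow_succ]]
      exact mul_le_mul_of_nonneg_right hBy hα0.le
    have h2 : η * ((∏ j ∈ S, y j) / α00 ^ S.card - 1) ≤ η * (1 / α00 - 1) :=
      mul_le_mul_of_nonneg_left (by linarith) hη0.le
    have h3 : (1 : ℝ) * (∏ j ∈ S, (1 + B j / 1) - 1) ≤ η * (1 / α00 - 1) := mono.trans h2
    rw [one_mul] at h3
    have h4 : εH * (∏ j ∈ S, (1 + B j / 1) - 1) ≤ εH * (η * (1 / α00 - 1)) := mul_le_mul_of_nonneg_left h3 hεH0.le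
    refine h4.trans (le_of_eq ?_)
    have e3 : η * (1 / α00 - 1) = p * (1 - α00) / uf := by rw [hη]; field_simp
    rw [e3, hεHd]; field_simp
  -- assemble
  have htot : ∏ j ∈ S, (1 + a j + b j) ≤ (c0 + p + s * (1 - τ)) / g := by
    have hnum : g + s * (1 - wf) + (1 - s) * (p * (1 - α00)) = c0 + p + s * (1 - τ) := by
      rw [hgeq, hδ, hwf, huf, hp]; ring
    have h1 : 1 + s * (1 - wf) / g + (1 - s) * (p * (1 - α00)) / g = (c0 + p + s * (1 - τ)) / g := by
      rw [← hnum]; field_simp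
    linarith
  rw [prod_congr rfl hfac, prod_const_mul',
    show g ^ S.card = g ^ (S.card - 1) * g by conv_lhs => rw [show S.card = (S.card - 1) + 1 by omega, pow_succ],
    mul_assoc]
  refine mul_le_mul_of_nonneg_left ?_ (by positivity)
  calc g * ∏ j ∈ S, (1 + a j + b j) ≤ g * ((c0 + p + s * (1 - τ)) / g) :=
        mul_le_mul_of_nonneg_left htot hgpos.le
    _ = c0 + p + s * (1 - τ) := mul_div_cancel₀ _ hgne

/-- **(RES0′) ∀n for every family with `y` at its floor, from the `{w=1}`-face budget alone.**  Every such family (all leverage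
dwarfs `(α₀₀,t,t,t)`, h-petals `(α₀₀,α₀₁,α₀₁,h)`, H-hubs `(α₀₀,1,1,1)`, k-hubs `(α₀₀,k,α₀₁,α₁₁)`, … in any mixture) is
W-dominant, so `res0_Wdominant` applies; the `y`-budget is automatic. [this work] -/
theorem res0_yfloor [DecidableEq κ] {τ σ s α00 α01 α11 c0 : ℝ} (hτ0 : 0 < τ) (hτ1 : τ < 1) (hσ0 : 0 ≤ σ)
    (hσ1 : σ < 1) (hs0 : 0 < s) (hs1 : s < 1) (hα0 : 0 < α00) (h01 : α00 ≤ α01) (h11 : α01 ≤ α11) (hα1 : α11 ≤ 1)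
    (hc0 : τ * σ + (1 - τ) * (1 - s) * α00 ≤ c0)
    (S : Finset κ) (hS : S.Nonempty) (k gc h : κ → ℝ)
    (hk : ∀ j ∈ S, α01 ≤ k j) (hg : ∀ j ∈ S, α01 ≤ gc j) (hh : ∀ j ∈ S, α11 ≤ h j)
    (hBW : ∏ j ∈ S, (τ * σ + τ * (1 - σ) * k j + (1 - τ) * ((1 - σ) * gc j + σ * h j)) ≤
      (τ * σ + τ * (1 - σ) * α01 + (1 - τ) * ((1 - σ) * α01 + σ * α11)) ^ (S.card - 1)) :
    ∏ j ∈ S, (c0 + τ * (1 - σ) * ((1 - s) * α00 + s * k j) + s * (1 - τ) * ((1 - σ) * gc j + σ * h j)) ≤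
      (c0 + τ * (1 - σ) * ((1 - s) * α00 + s * α01) + s * (1 - τ) * ((1 - σ) * α01 + σ * α11)) ^ (S.card - 1) *
        (c0 + τ * (1 - σ) + s * (1 - τ)) := by
  have hcard : 1 ≤ S.card := Finset.card_pos.2 hS
  refine res0_Wdominant hτ0 hτ1 hσ0 hσ1 hs0 hs1 hα0 h01 h11 hc0 S hS (fun _ => α00) k gc h (fun _ _ => le_rfl) hk hg hh
    ?_ hBW ?_
  · intro j hj
    rw [sub_self, mul_zero, mul_zero]
    have hτ1' : 0 < 1 - τ := sub_pos.2 hτ1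
    have hσ1' : 0 < 1 - σ := sub_pos.2 hσ1
    refine mul_nonneg ?_ (sub_nonneg.2 ?_)
    · nlinarith [mul_nonneg hτ0.le hσ0, mul_nonneg (mul_nonneg hτ0.le hσ1'.le) hα0.le, mul_pos hτ1' hα0]
    · have h1 := hk j hj; have h2 := hg j hj; have h3 := hh j hj
      have : (1 - σ) * α01 + σ * α11 ≤ (1 - σ) * gc j + σ * h j :=
        add_le_add (mul_le_mul_of_nonneg_left h2 hσ1'.le) (mul_le_mul_of_nonneg_left h3 hσ0)
      nlinarith [mul_le_mul_of_nonneg_left h1 (mul_nonneg hτ0.le hσ1'.le), mul_le_mul_of_nonneg_left this hτ1'.le]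
  · rw [prod_const]
    calc α00 ^ S.card = α00 ^ (S.card - 1) * α00 := by
          conv_lhs => rw [show S.card = (S.card - 1) + 1 by omega, pow_succ]
      _ ≤ α00 ^ (S.card - 1) * 1 := mul_le_mul_of_nonneg_left (by linarith [h01, h11, hα1]) (by positivity)
      _ = α00 ^ (S.card - 1) := mul_one _

end LinkedCurrency

end SafeCalc

end Summit.CriticalPhenomena.PercolationContinuityZ3.Theorems.SunflowerPartition
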